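import Literature.MathematicalPhysics.QuantumFieldTheory.King1986.MinimizerTowerBridge
import Summits.QuantumFields.YangMills.Theorems.BalabanUVNodesN15KingModelTranslationCovariance
import Summits.QuantumFields.YangMills.Theorems.BalabanUVNodesN15KingModelCycleResolventReadings
import HarnessLib

/-!
# BalabanUVNodes ∕ N15 — THE KING-MODEL RUNG (PART Ϲ-b): THE TIMESLICE CHANNELS OF KING's FREE TORUS COVARIANCE `B⁻¹ = (c(−Δ)+m²)⁻¹` ARE THE
# MASSIVE CYCLE RESOLVENT — `Σ_{z_κ = t} e^{ip·z} B⁻¹(z,0) = c⁻¹·cosh(ω_p(val t − n∕2))∕(2 sinh ω_p sinh(ω_p n∕2))` WITH THE LATTICE DISPERSION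
# RELATION `2c(cosh ω_p − 1) = m² + cΣ_{μ≠κ}(2 − 2cos p′_μ)`
# (Track A, DAG node N15 = NE2; FAN-OUT v1.1 §N15 s3 «KING-MODEL RUNG»; count-neutral)

HONEST FRAMING.  Count-neutral (cell `pub-ymgap`, seat `pub-ymgap-dag-n15-e` g38; `--supports stmt-QuantumFields-27366 --as helper` = K3⁸).
TEMPLATE LITERATURE: C. King, Commun. Math. Phys. **102** (1986) 649–677 [King1986] — King's OWN `A = 0` free operator `Δ^η + m²` ((4.4) p.670)
on a finite torus `Tor K = Π_μ ℤ∕K_μ` (the tree's `King1986.Torus.lapF K c m²`, `c = η⁻²`), with one axis `κ` read as Euclidean TIME.  The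
transfer-matrix reading is Montvay–Münster [MontvayMunster1994] §2.1.2: the timeslice correlation at spatial momentum `p`,
`C(t,p) = Σ_x e^{−ip·x} G((x,t),0)` (2.18)–(2.20), has the spectral form `Σ_α |c_α|² e^{−tE(p,α)}` (2.49), and for the free field the energy is
`cosh ω₀(p) = 1 + ½(m₀² + p̂²)` (2.75) (Drouffe–Zuber [DrouffeZuber1983] (3.43)–(3.46) p.41: `G(p,τ) ~ e^{−E₀(p)τ}`, `E₀(p) = Arg cosh(cosh m₀ + 1 − cos p)`).
THIS FILE PROVES the finite-torus, finite-`η` statement EXACTLY, for King's operator: every timeslice ∕ spatial-plane-wave channel of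
`B⁻¹` is `c⁻¹` times PART Ϲ-a's cycle resolvent at `x = lapSym(p)∕c`.  NOT Bałaban's covariant `C^{(k)}(Λ)`; NOT a node discharge (N15 is booked
through n15-a's knit, untouched); the transfer matrix itself is NOT constructed; nothing continuum ∕ ℝ⁴ ∕ OS axioms ∕ Yang–Mills gap ∕ Clay.  0 `sorry`, 0 `def`.

THE COMPUTATION (why no Fourier inversion is needed).  Let `G = B⁻¹(·,0)` and `S_p(t) = Σ_{z : z_κ = t} e^{ip·z}G(z)` for a momentum `p` with
`p_κ = 0`.  Summing the column equation `(BG)(z) = δ_{z,0}` over the slice `{z_κ = t}` against `e^{ip·z}`: spatial steps `±e_μ` (`μ ≠ κ`) permute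
the slice and multiply the character by `e^{∓ip′_μ}`, the time steps move the slice to `t ± 1` (§1), so
`c·[(2 + lapSym(p)∕c)·S_p(t) − S_p(t+1) − S_p(t−1)] = [t = 0]` (§2) — PART Ϲ-a's stencil equation on the cycle `ℤ∕K_κ` with mass² `lapSym(p)∕c`
and source `c⁻¹δ₀`, whose solution is unique (`eq_mul_cycleGreen_of_recurrence_complex`).

WHAT THIS FILE PROVES (kernel).  §1 slice bookkeeping: ★ `sum_slice_comp_add` (`Σ_{z_κ=t} f(z+e) = Σ_{z_κ = t+e_κ} f(z)`), `unitVec` letters.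
§2 ★★ `timeSlice_recurrence` (the stencil equation for `S_p`, every `p` with `p_κ = 0`).  §3 ★★★ **`timeSlice_chi_lapF_inv_eq_cycleGreen`**
(`S_p(t) = c⁻¹·cycleGreen (K κ) (lapSym K c m² p ∕ c) t` — THE LATTICE DISPERSION RELATION: channel `p` is a pure `cosh` in `t` with rate
`ω_p = latticeMass(lapSym(p)∕c)`, i.e. `2c(cosh ω_p − 1) = m² + cΣ_{μ≠κ}(2 − 2cos p′_μ)`, King's symbol (4.4) at imaginary time-momentum),
★★★ **`timeSlice_lapF_inv_eq_cycleGreen`** (`p = 0`: `Σ_{z_κ = t} B⁻¹(z,0) = c⁻¹·cycleGreen (K κ) (m²∕c) t` — THE ZERO-MOMENTUM TIMESLICE CORRELATOR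
OF KING's FINE FREE FIELD IS THE CYCLE RESOLVENT WITH MASS `ω₀ = latticeMass(m²∕c)`, `2 sinh(ω₀∕2) = √(m²∕c)`), `timeSlice_lapF_inv_pos`,
★★ `latticeMass_lapSym_ge` (`ω_p ≥ ω₀`: the zero-momentum channel decays slowest — the MASS GAP of the timeslice tower), `lapSym_div_eq_of_apply_eq_zero`.

HONEST SCOPE.  `c > 0`, `m² > 0`, any torus `K : Fin d → ℕ` (all `K_μ ≥ 1`), any axis `κ`; momenta restricted to `p_κ = 0` (purely spatial plane
waves); the source sits at `0` (general sources by `lapF_inv_transl`, PART Ϙ-a).  The `η`-bookkeeping in King's units `c = N²` (mass per unit length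
`N·ω₀ → √m²` at rate `N^{−2}`) and the RG block-field law are in `…KingModelTorusMassGap` ∕ `…KingModelBlockFieldMassGap`.
Locators: [King1986] (4.4) p.670, (2.16)–(2.17) p.653; [MontvayMunster1994] §2.1.2 (2.18)–(2.20), (2.49), §2.2.1 (2.72)–(2.76); [DrouffeZuber1983] (3.43)–(3.46) p.41.
-/

noncomputable section

open scoped BigOperators ComplexConjugate
open Finset Matrix Real

namespace Summit.QuantumFields.YangMills.BalabanUVNodes.N15KingModelRung.TorusSpectral

open Literature.MathematicalPhysics.QuantumFieldTheory.Balaban1983to89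
open Literature.MathematicalPhysics.QuantumFieldTheory.Balaban1983to89.B5Prop11Plancherel
open Literature.MathematicalPhysics.QuantumFieldTheory.Balaban1983to89.QGQInverse (isUnit_of_coercive)
open Literature.MathematicalPhysics.QuantumFieldTheory.King1986.Torus

variable {d : ℕ} (K : Fin d → ℕ) [hK : ∀ μ, NeZero (K μ)] (κ : Fin d)

/-! ## §1 Slice bookkeeping: spatial steps preserve a timeslice, time steps move it -/

section Slices

omit hK in
/-- `e_μ` has `μ`-component `1`. [folklore] -/
private theorem unitVec_at_same (μ : Fin d) : unitVec K μ μ = 1 := by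
  simp [unitVec]

omit hK in
/-- `e_μ` has `ν`-component `0` for `ν ≠ μ`. [folklore] -/
private theorem unitVec_at_ne {μ ν : Fin d} (h : ν ≠ μ) : unitVec K μ ν = 0 := by
  simp [unitVec, h]

variable {α : Type*} [AddCommMonoid α]

/-- ★ SLICE REINDEXING: `Σ_{z : z_κ = t} f(z + e) = Σ_{z : z_κ = t + e_κ} f(z)` (translation by `e` maps the slice `t` onto the slice `t + e_κ`).
[folklore] -/
theorem sum_slice_comp_add (f : Tor K → α) (e : Tor K) (t : ZMod (K κ)) :
    ∑ z : Tor K, (if z κ = t then f (z + e) else 0) = ∑ z : Tor K, (if z κ = t + e κ then f z else 0) := by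
  refine Fintype.sum_equiv (Equiv.addRight e) _ _ fun z => ?_
  simp only [Equiv.coe_addRight, Pi.add_apply, add_left_inj]

/-- Spatial step `+e_μ`, `μ ≠ κ`: the slice is preserved. [folklore] -/
theorem sum_slice_add_unitVec_of_ne {μ : Fin d} (hμ : μ ≠ κ) (f : Tor K → α) (t : ZMod (K κ)) :
    ∑ z : Tor K, (if z κ = t then f (z + unitVec K μ) else 0) = ∑ z : Tor K, (if z κ = t then f z else 0) := by
  rw [sum_slice_comp_add, unitVec_at_ne K (Ne.symm hμ), add_zero]

/-- Spatial step `−e_μ`, `μ ≠ κ`: the slice is preserved. [folklore] -/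
theorem sum_slice_sub_unitVec_of_ne {μ : Fin d} (hμ : μ ≠ κ) (f : Tor K → α) (t : ZMod (K κ)) :
    ∑ z : Tor K, (if z κ = t then f (z - unitVec K μ) else 0) = ∑ z : Tor K, (if z κ = t then f z else 0) := by
  simp_rw [sub_eq_add_neg]
  rw [sum_slice_comp_add, Pi.neg_apply, unitVec_at_ne K (Ne.symm hμ), neg_zero, add_zero]

/-- Time step `+e_κ`: the slice `t` becomes the slice `t + 1`. [folklore] -/
theorem sum_slice_add_unitVec_same (f : Tor K → α) (t : ZMod (K κ)) :
    ∑ z : Tor K, (if z κ = t then f (z + unitVec K κ) else 0) = ∑ z : Tor K, (if z κ = t + 1 then f z else 0) := by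
  rw [sum_slice_comp_add, unitVec_at_same]

/-- Time step `−e_κ`: the slice `t` becomes the slice `t − 1`. [folklore] -/
theorem sum_slice_sub_unitVec_same (f : Tor K → α) (t : ZMod (K κ)) :
    ∑ z : Tor K, (if z κ = t then f (z - unitVec K κ) else 0) = ∑ z : Tor K, (if z κ = t - 1 then f z else 0) := by
  simp_rw [sub_eq_add_neg]
  rw [sum_slice_comp_add, Pi.neg_apply, unitVec_at_same]

end Slices

/-! ## §2 The stencil equation of a timeslice channel -/

section Recurrence

variable {c m2 : ℝ}

omit hK in
/-- For a purely spatial momentum (`p_κ = 0`), `lapSym(p)∕c = m²∕c + Σ_{μ}(2 − 2cos p′_μ)` and the `κ`-term vanishes: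
`Σ_μ 2cos p′_μ = 2 + Σ_{μ≠κ} 2cos p′_μ`, i.e. `m² + 2dc − c·Σ_{μ ≠ κ} 2cos p′_μ = lapSym(p) + 2c`. [cite: King1986, (4.4) p.670] -/
theorem lapSym_add_two_mul_eq {p : Tor K} (hp : p κ = 0) (c m2 : ℝ) :
    lapSym K c m2 p + 2 * c = m2 + 2 * d * c - c * ∑ μ ∈ Finset.univ.erase κ, 2 * Real.cos (sOf K p μ) := by
  unfold lapSym
  have hκ : Real.cos (sOf K p κ) = 1 := by simp [sOf, hp]
  rw [Finset.sum_erase_eq_sub (Finset.mem_univ κ), hκ, Finset.sum_sub_distrib, Finset.sum_const, Finset.card_univ, Fintype.card_fin]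
  simp only [nsmul_eq_mul]
  ring

/-- ★★ **THE STENCIL EQUATION OF A TIMESLICE CHANNEL.**  For `p_κ = 0`, `c > 0`, `m² > 0` and `S_p(t) = Σ_{z_κ = t} e^{ip·z}B⁻¹(z,0)`:
`(2 + lapSym(p)∕c)·S_p(t) − (S_p(t+1) + S_p(t−1)) = c⁻¹·[t = 0]` — the column equation `B·B⁻¹(·,0) = δ₀` summed over the slice against the plane
wave: spatial steps give the symbol, time steps the second difference. [cite: King1986, (4.4) p.670; MontvayMunster1994, §2.1.2 (2.18)–(2.20)] -/
theorem timeSlice_recurrence (hc : 0 < c) (hm : 0 < m2) {p : Tor K} (hp : p κ = 0) (t : ZMod (K κ)) :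
    (2 + (lapSym K c m2 p / c : ℝ)) * (∑ z : Tor K, (if z κ = t then chi K p z * ((lapF K c m2)⁻¹ z 0 : ℂ) else 0))
      - ((∑ z : Tor K, (if z κ = t + 1 then chi K p z * ((lapF K c m2)⁻¹ z 0 : ℂ) else 0))
        + (∑ z : Tor K, (if z κ = t - 1 then chi K p z * ((lapF K c m2)⁻¹ z 0 : ℂ) else 0)))
      = if t = 0 then ((c⁻¹ : ℝ) : ℂ) else 0 := by
  set G : Tor K → ℝ := fun z => (lapF K c m2)⁻¹ z 0 with hGdef
  set S : ZMod (K κ) → ℂ := fun s => ∑ z : Tor K, (if z κ = s then chi K p z * (G z : ℂ) else 0) with hSdef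
  -- the column equation `B·G = δ₀`
  have hU : IsUnit (lapF K c m2).det :=
    (Matrix.isUnit_iff_isUnit_det _).mp (isUnit_of_coercive hm (lapF_coercive K c m2 hc.le))
  have hcol : ∀ z, (lapF K c m2 *ᵥ G) z = if z = 0 then 1 else 0 := by
    intro z
    have h := congr_fun (congr_fun (Matrix.mul_nonsing_inv (lapF K c m2) hU) z) 0
    rw [Matrix.mul_apply, Matrix.one_apply] at h
    simpa [Matrix.mulVec, dotProduct, hGdef] using h
  -- characters under steps: `e^{ip·(z ∓ e_μ)} = e^{ip·z}·e^{∓ip·e_μ}`; along `κ` the phase is `1`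
  have hphase : ∀ (μ : Fin d) (z : Tor K), chi K p z = chi K p (z + unitVec K μ) * chi K p (-unitVec K μ) := by
    intro μ z; rw [← chi_add_right, add_neg_cancel_right]
  have hphase' : ∀ (μ : Fin d) (z : Tor K), chi K p z = chi K p (z - unitVec K μ) * chi K p (unitVec K μ) := by
    intro μ z; rw [← chi_add_right, sub_add_cancel]
  have hκplus : chi K p (unitVec K κ) = 1 := by rw [chi_unitVec, hp, AddChar.map_zero_eq_one]
  have hκminus : chi K p (-unitVec K κ) = 1 := by rw [← chi_neg_left, chi_unitVec, Pi.neg_apply, hp, neg_zero, AddChar.map_zero_eq_one]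
  -- the shifted slice sums
  have hplus : ∀ μ : Fin d, ∑ z : Tor K, (if z κ = t then chi K p z * (G (z + unitVec K μ) : ℂ) else 0)
      = chi K p (-unitVec K μ) * S (t + unitVec K μ κ) := by
    intro μ
    have : ∀ z : Tor K, chi K p z * (G (z + unitVec K μ) : ℂ)
        = (fun w => chi K p (-unitVec K μ) * (chi K p w * (G w : ℂ))) (z + unitVec K μ) := by
      intro z; simp only; rw [hphase μ z]; ring
    simp_rw [this]
    rw [sum_slice_comp_add K κ (fun w => chi K p (-unitVec K μ) * (chi K p w * (G w : ℂ))), hSdef]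
    simp only
    rw [Finset.mul_sum]
    refine Finset.sum_congr rfl fun z _ => ?_
    split_ifs <;> simp
  have hminus : ∀ μ : Fin d, ∑ z : Tor K, (if z κ = t then chi K p z * (G (z - unitVec K μ) : ℂ) else 0)
      = chi K p (unitVec K μ) * S (t - unitVec K μ κ) := by
    intro μ
    have : ∀ z : Tor K, chi K p z * (G (z - unitVec K μ) : ℂ)
        = (fun w => chi K p (unitVec K μ) * (chi K p w * (G w : ℂ))) (z + -unitVec K μ) := by
      intro z; simp only; rw [hphase' μ z, ← sub_eq_add_neg]; ring
    simp_rw [this]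
    rw [sum_slice_comp_add K κ (fun w => chi K p (unitVec K μ) * (chi K p w * (G w : ℂ))), hSdef, Pi.neg_apply, ← sub_eq_add_neg]
    simp only
    rw [Finset.mul_sum]
    refine Finset.sum_congr rfl fun z _ => ?_
    split_ifs <;> simp
  -- sum the column equation over the slice against the character: the source term
  have hlhs : ∑ z : Tor K, (if z κ = t then chi K p z * ((lapF K c m2 *ᵥ G) z : ℂ) else 0) = if t = 0 then 1 else 0 := by
    simp_rw [hcol]
    rw [Finset.sum_eq_single (0 : Tor K)]
    · simp only [Pi.zero_apply, if_true, B5Block118.chi_zero_right, Complex.ofReal_one, mul_one]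
      by_cases ht : t = 0
      · rw [if_pos ht, if_pos ht.symm]
      · rw [if_neg ht, if_neg (Ne.symm ht)]
    · intro z _ hz; rw [if_neg hz]; simp
    · intro h; exact absurd (Finset.mem_univ _) h
  -- expand the stencil inside the slice sum
  have hpt : ∀ x : Tor K, (if x κ = t then chi K p x * ((lapF K c m2 *ᵥ G) x : ℂ) else 0)
      = ((m2 + 2 * d * c : ℝ) : ℂ) * (if x κ = t then chi K p x * (G x : ℂ) else 0)
        - (c : ℂ) * ∑ μ : Fin d, ((if x κ = t then chi K p x * (G (x + unitVec K μ) : ℂ) else 0)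
            + (if x κ = t then chi K p x * (G (x - unitVec K μ) : ℂ) else 0)) := by
    intro x
    rw [lapF_mulVec_apply]
    by_cases hx : x κ = t
    · simp only [hx, if_true]
      push_cast
      simp only [mul_sub, mul_add, Finset.mul_sum, Finset.sum_add_distrib]
      ring_nf
    · simp only [hx, if_false, mul_zero, add_zero, Finset.sum_const_zero, sub_zero]
  have hexp : ∑ z : Tor K, (if z κ = t then chi K p z * ((lapF K c m2 *ᵥ G) z : ℂ) else 0)
      = ((m2 + 2 * d * c : ℝ) : ℂ) * S t
        - (c : ℂ) * ((∑ μ : Fin d, chi K p (-unitVec K μ) * S (t + unitVec K μ κ))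
          + (∑ μ : Fin d, chi K p (unitVec K μ) * S (t - unitVec K μ κ))) := by
    rw [Finset.sum_congr rfl fun x _ => hpt x, Finset.sum_sub_distrib, ← Finset.mul_sum, ← Finset.mul_sum, Finset.sum_comm]
    simp_rw [Finset.sum_add_distrib, hplus, hminus]
    rfl
  -- split the direction sums at `κ`
  have hP : ∑ μ : Fin d, chi K p (-unitVec K μ) * S (t + unitVec K μ κ)
      = S (t + 1) + (∑ μ ∈ Finset.univ.erase κ, chi K p (-unitVec K μ)) * S t := by
    rw [← Finset.add_sum_erase _ _ (Finset.mem_univ κ), unitVec_at_same, hκminus, one_mul, Finset.sum_mul]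
    congr 1
    refine Finset.sum_congr rfl fun μ hμ => ?_
    rw [unitVec_at_ne K (Ne.symm (Finset.ne_of_mem_erase hμ)), add_zero]
  have hQ : ∑ μ : Fin d, chi K p (unitVec K μ) * S (t - unitVec K μ κ)
      = S (t - 1) + (∑ μ ∈ Finset.univ.erase κ, chi K p (unitVec K μ)) * S t := by
    rw [← Finset.add_sum_erase _ _ (Finset.mem_univ κ), unitVec_at_same, hκplus, one_mul, Finset.sum_mul]
    congr 1
    refine Finset.sum_congr rfl fun μ hμ => ?_
    rw [unitVec_at_ne K (Ne.symm (Finset.ne_of_mem_erase hμ)), sub_zero]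
  have hcos : (∑ μ ∈ Finset.univ.erase κ, chi K p (-unitVec K μ)) + (∑ μ ∈ Finset.univ.erase κ, chi K p (unitVec K μ))
      = ((∑ μ ∈ Finset.univ.erase κ, 2 * Real.cos (sOf K p μ) : ℝ) : ℂ) := by
    push_cast
    rw [← Finset.sum_add_distrib]
    refine Finset.sum_congr rfl fun μ _ => ?_
    rw [add_comm, chi_unitVec_add_chi_neg]; push_cast; ring
  -- assemble
  have hsym := lapSym_add_two_mul_eq K κ hp c m2
  have hc0 : (c : ℂ) ≠ 0 := by exact_mod_cast hc.ne'
  have h2 : ((2 + lapSym K c m2 p / c : ℝ) : ℂ) * (c : ℂ)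
      = ((m2 + 2 * d * c : ℝ) : ℂ) - (c : ℂ) * ((∑ μ ∈ Finset.univ.erase κ, 2 * Real.cos (sOf K p μ) : ℝ) : ℂ) := by
    have : (2 + lapSym K c m2 p / c) * c = m2 + 2 * d * c - c * ∑ μ ∈ Finset.univ.erase κ, 2 * Real.cos (sOf K p μ) := by
      rw [← hsym]; field_simp; ring
    exact_mod_cast this
  rw [← hcos] at h2
  have key : (c : ℂ) * (((2 + lapSym K c m2 p / c : ℝ) : ℂ) * S t - (S (t + 1) + S (t - 1))) = if t = 0 then 1 else 0 := by
    rw [← hlhs, hexp, hP, hQ]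
    linear_combination (S t) * h2
  have hfinal : ((2 + lapSym K c m2 p / c : ℝ) : ℂ) * S t - (S (t + 1) + S (t - 1)) = if t = 0 then ((c⁻¹ : ℝ) : ℂ) else 0 := by
    have := congr_arg (fun w => (c : ℂ)⁻¹ * w) key
    simp only [← mul_assoc, inv_mul_cancel₀ hc0, one_mul] at this
    rw [this]
    split_ifs <;> simp
  push_cast at hfinal ⊢
  simpa only [hSdef, hGdef] using hfinal

end Recurrence

/-! ## §3 The channels in closed form: the lattice dispersion relation and the zero-momentum correlator -/

section Channels

variable {c m2 : ℝ}

omit hK in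
/-- For a purely spatial momentum, `lapSym(p)∕c = m²∕c + Σ_{μ≠κ}(2 − 2cos p′_μ) ≥ m²∕c > 0`. [cite: King1986, (4.4) p.670] -/
theorem lapSym_div_pos (hc : 0 < c) (hm : 0 < m2) (p : Tor K) : 0 < lapSym K c m2 p / c :=
  div_pos (lt_of_lt_of_le hm (lapSym_ge K c m2 hc.le p)) hc

/-- ★★★ **THE LATTICE DISPERSION RELATION — EVERY TIMESLICE CHANNEL OF KING's FREE TORUS COVARIANCE IS THE MASSIVE CYCLE RESOLVENT.**  For
`c > 0`, `m² > 0`, any torus `Tor K`, any time axis `κ` and any purely spatial momentum `p` (`p_κ = 0`):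
`Σ_{z : z_κ = t} e^{ip·z}·B⁻¹(z,0) = c⁻¹ · cosh(ω_p(val t − K_κ∕2)) ∕ (2 sinh ω_p · sinh(ω_p K_κ∕2))` with `ω_p = latticeMass(lapSym(p)∕c)`, i.e.
`2c(cosh ω_p − 1) = m² + cΣ_{μ≠κ}(2 − 2cos p′_μ)` — King's symbol (4.4) continued to imaginary time-momentum; the channel is a PURE `cosh` in `t`
(one «particle» of energy `ω_p` per spatial momentum, and its image around the period).
[cite: King1986, (4.4) p.670; MontvayMunster1994, §2.1.2 (2.18)–(2.20), (2.49), §2.2.1 (2.74)–(2.76); DrouffeZuber1983, (3.43)–(3.46) p.41] -/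
theorem timeSlice_chi_lapF_inv_eq_cycleGreen (hc : 0 < c) (hm : 0 < m2) {p : Tor K} (hp : p κ = 0) (t : ZMod (K κ)) :
    ∑ z : Tor K, (if z κ = t then chi K p z * ((lapF K c m2)⁻¹ z 0 : ℂ) else 0)
      = ((c⁻¹ * cycleGreen (K κ) (lapSym K c m2 p / c) t : ℝ) : ℂ) := by
  have h := eq_mul_cycleGreen_of_recurrence_complex (K κ) (lapSym_div_pos K hc hm p)
    (fun s => ∑ z : Tor K, (if z κ = s then chi K p z * ((lapF K c m2)⁻¹ z 0 : ℂ) else 0)) ((c⁻¹ : ℝ) : ℂ)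
    (timeSlice_recurrence K κ hc hm hp) t
  push_cast at h ⊢
  exact h

/-- ★★★ **THE ZERO-MOMENTUM TIMESLICE CORRELATOR OF KING's FINE FREE FIELD IS THE CYCLE RESOLVENT**: for `c > 0`, `m² > 0`, every torus and axis,
`Σ_{z : z_κ = t} B⁻¹(z,0) = c⁻¹ · cosh(ω₀(val t − K_κ∕2)) ∕ (2 sinh ω₀ · sinh(ω₀ K_κ∕2))`, `ω₀ = latticeMass(m²∕c)` (`2 sinh(ω₀∕2) = √(m²∕c)`) — the
transfer-matrix form of the two-point function of the spatially averaged field on the periodic time axis, with the MASS GAP `ω₀` as its only rate.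
[cite: King1986, (4.4) p.670, (2.16)–(2.17) p.653; MontvayMunster1994, §2.1.2 (2.49), §2.2.1 (2.74)–(2.78)] -/
theorem timeSlice_lapF_inv_eq_cycleGreen (hc : 0 < c) (hm : 0 < m2) (t : ZMod (K κ)) :
    ∑ z : Tor K, (if z κ = t then (lapF K c m2)⁻¹ z 0 else 0) = c⁻¹ * cycleGreen (K κ) (m2 / c) t := by
  have h := timeSlice_chi_lapF_inv_eq_cycleGreen K κ hc hm (p := 0) rfl t
  have hsym : lapSym K c m2 (0 : Tor K) = m2 := by simp [lapSym]
  have hcast : ∀ z : Tor K, (if z κ = t then chi K 0 z * ((lapF K c m2)⁻¹ z 0 : ℂ) else 0)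
      = ((if z κ = t then (lapF K c m2)⁻¹ z 0 else 0 : ℝ) : ℂ) := by
    intro z; rw [chi_zero_left, one_mul]; split_ifs <;> simp
  simp_rw [hcast, ← Complex.ofReal_sum, hsym] at h
  exact_mod_cast h

/-- The zero-momentum timeslice correlator is STRICTLY POSITIVE at every separation. [folklore] -/
theorem timeSlice_lapF_inv_pos (hc : 0 < c) (hm : 0 < m2) (t : ZMod (K κ)) :
    0 < ∑ z : Tor K, (if z κ = t then (lapF K c m2)⁻¹ z 0 else 0) := by
  rw [timeSlice_lapF_inv_eq_cycleGreen K κ hc hm]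
  exact mul_pos (inv_pos.mpr hc) (cycleGreen_pos (K κ) (div_pos hm hc) t)

omit hK in
/-- ★★ **THE ZERO-MOMENTUM CHANNEL DECAYS SLOWEST**: `ω₀ = latticeMass(m²∕c) ≤ ω_p = latticeMass(lapSym(p)∕c)` for every momentum `p` — the energies of
the timeslice tower are bounded below by the mass gap. [cite: MontvayMunster1994, §2.1.2 (2.50)–(2.51), §2.2.1 (2.76)] -/
theorem latticeMass_lapSym_ge (hc : 0 < c) (m2 : ℝ) (p : Tor K) :
    latticeMass (m2 / c) ≤ latticeMass (lapSym K c m2 p / c) :=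
  latticeMass_le_latticeMass (div_le_div_of_nonneg_right (lapSym_ge K c m2 hc.le p) hc.le)

/-- A general source: `Σ_{z : z_κ = s} B⁻¹(z,y) = Σ_{w : w_κ = s − y_κ} B⁻¹(w,0)` (translation invariance of `B⁻¹`, PART Ϙ-a), so every timeslice
channel between slices `s` and `y_κ` is the cycle resolvent at separation `s − y_κ`. [cite: King1986, (2.17) p.653, (4.4) p.670] -/
theorem timeSlice_lapF_inv_source (c m2 : ℝ) (y : Tor K) (s : ZMod (K κ)) :
    ∑ z : Tor K, (if z κ = s then (lapF K c m2)⁻¹ z y else 0) = ∑ w : Tor K, (if w κ = s - y κ then (lapF K c m2)⁻¹ w 0 else 0) := by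
  set G : Tor K → ℝ := fun w => (lapF K c m2)⁻¹ w 0 with hG
  have h : ∀ z : Tor K, (lapF K c m2)⁻¹ z y = G (z + -y) := by
    intro z
    show (lapF K c m2)⁻¹ z y = (lapF K c m2)⁻¹ (z + -y) 0
    rw [← Transl.lapF_inv_transl K c m2 (z + -y) 0 y, neg_add_cancel_right, zero_add]
  have h2 : ∑ z : Tor K, (if z κ = s then (lapF K c m2)⁻¹ z y else 0) = ∑ z : Tor K, (if z κ = s then G (z + -y) else 0) :=
    Finset.sum_congr rfl fun z _ => by rw [h]
  rw [h2, sum_slice_comp_add K κ G (-y) s, Pi.neg_apply, ← sub_eq_add_neg]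

/-- ★★ The zero-momentum correlator between ANY two slices: `Σ_{z : z_κ = s} B⁻¹(z,y) = c⁻¹·cycleGreen (K κ) (m²∕c) (s − y_κ)`.
[cite: King1986, (4.4) p.670; MontvayMunster1994, §2.1.2 (2.20)] -/
theorem timeSlice_lapF_inv_eq_cycleGreen_source (hc : 0 < c) (hm : 0 < m2) (y : Tor K) (s : ZMod (K κ)) :
    ∑ z : Tor K, (if z κ = s then (lapF K c m2)⁻¹ z y else 0) = c⁻¹ * cycleGreen (K κ) (m2 / c) (s - y κ) := by
  rw [timeSlice_lapF_inv_source, timeSlice_lapF_inv_eq_cycleGreen K κ hc hm]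

end Channels

end Summit.QuantumFields.YangMills.BalabanUVNodes.N15KingModelRung.TorusSpectral
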